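import Summits.QuantumFields.BalabanUV.Beta.FP.CoarseCovarianceStripAlias

/-!
# `BalabanUV.Beta.FP.CoarseCovarianceStrip` — road «FP» (binder row D1), row H′2-IR ∕ IR-2 (ii): **THE MATRIX FACTORISATION OF THE COARSE
# COVARIANCE SYMBOL OF RECORD AT A COMPLEX COARSE MOMENTUM** — `Ĉ_n(k) = n^{−(3D+2)}·D_0·PC(k/n)·B_n(k)·D_0^-`, `B_n = 1 + E_n`,
# `E_n := feynC(k/n)·D_0⁻¹·F̃_n·(D_0^-)⁻¹` (all the `|k|⁻²` lives in `PC(k/n)`; `E_n` is built from the `l ≠ 0` alias terms only and is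
# n-UNIFORMLY BOUNDED on the fat region), and the INVERSE SYMBOL `G_C(k) := n^{3D+2}·(D_0^-)⁻¹·B_n⁻¹·feynC(k/n)·D_0⁻¹` with `G_C·Ĉ_n = 1`

HONEST FRAMING (cell contract, verbatim): «discharging `BetaPertH` makes Bałaban's UV stability UNCONDITIONAL — a real constructive-QFT
result; it is NOT the continuum limit and NOT the Clay problem.»  HONEST DEPENDENCY (verbatim): «continuum YM on T⁴ ⇐ BetaPertH ∧ nine
spine estimates (0/9 proved); BetaPertH ⇐ (D1) ∧ (D4) ∧ CAP+tail; G-an2-4 gates asym, D1 and NE2/3/4.»  THIS MODULE DISCHARGES NOTHING of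
D1 ∕ BetaPertH: [folklore] matrix algebra over leaf-02-g7's symbol of record `covSymMean` (`CoarseCovarianceAlias`), files (F)(A)(Alias) of this
row BY NAME.  [our object] data defs `Dw`, `Dwm`, `Dwi`, `Dwmi`, `aliasTerm`, `Chol`, `Ftil`, `En`, `Bn`, `GC`; no `def … : Prop`; nothing is
cited; 0 sorry.  NOT summit progress; NOT BetaPertH, NOT continuum, NOT Clay.

ABSOLUTE RULE (cell, verbatim): «No internally-minted statement may enter as a cited fact. Every hypothesis is either kernel-proved in this
package or a verbatim quotation of a PUBLISHED theorem with page reference. The manuscript(s) under audit are NOT citable for their own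
disputed steps — they are the thing under adjudication; programme-internal (2001/route/tribunal) claims are never citable.»

STRUCTURE FINDING (INTENT journal l.22234, tree-certified by `B4Strip.printed_factor_has_poles`): the design memo's scalar split
`n⁻²[|k̂|⁻²Θ_n + F_n]` cannot be strip-analytic; the analytic regrouping is by the ENTIRE MATRIX `feynC(k/n)`, whose inverse is the `l = 0`
propagator — this file is that regrouping.

CONTENT (`D = d+1`, `N := n^{3D+2}`, `k₀ := k/n = aliasPt n 0 k`).
* §1 [our object] the alias weight matrices `Dw`∕`Dwm` (diagonal, entries `cweight n κ (k_l)`, `cweight n λ (−k_l)`) and their explicit inverses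
  `Dwi`∕`Dwmi`; `aliasTerm n l k := Dw·PC(k_l)·Dwm`; **`Chol n k`** (the symbol of record `covSymMean n κ λ (PC · κ λ) k` as a matrix);
  `Chol_eq_sum` (`Chol = N⁻¹ • Σ_l aliasTerm`), `Ftil := Σ_{l≠0} aliasTerm`, `Chol_split`; **`En`**, **`Bn := 1 + En`**, **`GC`**.
* §2 algebra on the fat region `Fat D rA` (where the `l = 0` weights do not vanish): `Dw_mul_Dwi` & co., **`Chol_structure`**
  (`IsUnit (feynC k₀).det → Chol = N⁻¹ • Dw₀·PC(k₀)·Bn·Dwm₀`), **`Bn_eq`** (`Bn = N • feynC(k₀)·Dwi₀·Chol·Dwmi₀`), **`GC_mul_Chol`** ∕ `Chol_mul_GC`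
  (`= 1` given `IsUnit (feynC k₀).det`, `IsUnit (Bn).det`), `GC_eq_Chol_inv`, `isUnit_Chol_det`, `Bn_left_inv` ∕ **`Bn_inv_eq`**
  (`Bn⁻¹ = N⁻¹ • Dwm₀·Chol⁻¹·Dw₀·PC(k₀)`) ∕ `isUnit_Bn_det` (given `IsUnit (feynC k₀).det`, `IsUnit (Chol).det`).
* §3 the zero momentum: `feynC_zero`, `En_zero`, `Bn_zero` (`= 1`), `GC_zero` (`= 0`).
* §4 (entry formulas, the n-UNIFORM BOUND `‖En n k α β‖ ≤ ME d` on `Fat D rA`): the sequel `FP/CoarseCovarianceStripBound`.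
Unit `b2b-balaban-beta-d1-formalise-leaf-06` (gen 8), owner ruling R-FP-21 (A3)∕(C).
-/

noncomputable section

namespace Summit.QuantumFields.BalabanUV.Beta.FP.CoarseCovarianceStrip

open Finset Complex Set Metric Matrix
open scoped BigOperators ComplexConjugate
open Literature.MathematicalPhysics.QuantumFieldTheory.Balaban1983to89
open B4Strip (Strip ofRealVec reVec S1 Delta1 U)
open B4StripCauchy (Fat)
open B5Symbol166Strip (kappa166 kappa166_pos)
open Summit.QuantumFields.BalabanUV.Beta.GAN24.FibreSymbols (gsum)
open Summit.QuantumFields.BalabanUV.Beta.GAN24.AliasDecimate (aliasPt)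
open Summit.QuantumFields.BalabanUV.Beta.GAN24.PushSumSymbol (cweight)
open Summit.QuantumFields.BalabanUV.Beta.FP.PerfectSymbol166StripReg (bound166 bound166_nonneg)
open Summit.QuantumFields.BalabanUV.Beta.FP.PerfectPropagatorSymbol (curlRow)
open Summit.QuantumFields.BalabanUV.Beta.FP.CoarseCovarianceAlias (covSymMean covSymMean_apply)
open Summit.QuantumFields.BalabanUV.Beta.FP.CoarseCovarianceStripW
open Summit.QuantumFields.BalabanUV.Beta.FP.CoarseCovarianceStripFeyn
open Summit.QuantumFields.BalabanUV.Beta.FP.CoarseCovarianceStripFeynReg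
open Summit.QuantumFields.BalabanUV.Beta.FP.CoarseCovarianceStripProp
open Summit.QuantumFields.BalabanUV.Beta.FP.CoarseCovarianceStripPropCone
open Summit.QuantumFields.BalabanUV.Beta.FP.CoarseCovarianceStripAlias
open Summit.QuantumFields.BalabanUV.Beta.FP.CoarseCovarianceStripAliasWeights (aliasPt_apply' aliasPt_im)

variable {d : ℕ}

/-! ## §1 The objects -/

/-- [our object] the alias weight matrix `Dw n l k := diag_κ cweight n κ (k_l)`. -/
def Dw (n : ℕ) (l : Fin (d + 1) → Fin n) (k : Fin (d + 1) → ℂ) : Matrix (Fin (d + 1)) (Fin (d + 1)) ℂ :=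
  diagonal fun κ => cweight n κ (aliasPt n l k)

/-- [our object] the reflected alias weight matrix `Dwm n l k := diag_λ cweight n λ (−k_l)`. -/
def Dwm (n : ℕ) (l : Fin (d + 1) → Fin n) (k : Fin (d + 1) → ℂ) : Matrix (Fin (d + 1)) (Fin (d + 1)) ℂ :=
  diagonal fun lam => cweight n lam (-aliasPt n l k)

/-- [our object] the explicit inverse `Dwi n l k := diag_κ (cweight n κ (k_l))⁻¹`. -/
def Dwi (n : ℕ) (l : Fin (d + 1) → Fin n) (k : Fin (d + 1) → ℂ) : Matrix (Fin (d + 1)) (Fin (d + 1)) ℂ :=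
  diagonal fun κ => (cweight n κ (aliasPt n l k))⁻¹

/-- [our object] the explicit inverse `Dwmi n l k := diag_λ (cweight n λ (−k_l))⁻¹`. -/
def Dwmi (n : ℕ) (l : Fin (d + 1) → Fin n) (k : Fin (d + 1) → ℂ) : Matrix (Fin (d + 1)) (Fin (d + 1)) ℂ :=
  diagonal fun lam => (cweight n lam (-aliasPt n l k))⁻¹

/-- [our object] one alias term of the symbol of record: `aliasTerm n l k := Dw·PC(k_l)·Dwm`. -/
def aliasTerm (n : ℕ) (l : Fin (d + 1) → Fin n) (k : Fin (d + 1) → ℂ) : Matrix (Fin (d + 1)) (Fin (d + 1)) ℂ :=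
  Dw n l k * PC (aliasPt n l k) * Dwm n l k

/-- [folklore] entries of an alias term. -/
theorem aliasTerm_apply (n : ℕ) (l : Fin (d + 1) → Fin n) (k : Fin (d + 1) → ℂ) (κ lam : Fin (d + 1)) :
    aliasTerm n l k κ lam = cweight n κ (aliasPt n l k) * cweight n lam (-aliasPt n l k) * PC (aliasPt n l k) κ lam := by
  rw [aliasTerm, Dwm, mul_diagonal, Dw, diagonal_mul]
  ring

/-- [our object] **THE COARSE COVARIANCE SYMBOL OF RECORD AS A MATRIX**: `Chol n k κ λ := covSymMean n κ λ (p ↦ PC p κ λ) k`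
(leaf-02-g7's `Ĉ_n^{mean}` with the holomorphic perfect propagator symbol `PC` of file (F) inserted). -/
def Chol (n : ℕ) (k : Fin (d + 1) → ℂ) : Matrix (Fin (d + 1)) (Fin (d + 1)) ℂ :=
  Matrix.of fun κ lam => covSymMean n κ lam (fun p => PC p κ lam) k

/-- [folklore] entries of `Chol`. -/
theorem Chol_apply (n : ℕ) (k : Fin (d + 1) → ℂ) (κ lam : Fin (d + 1)) :
    Chol n k κ lam = covSymMean n κ lam (fun p => PC p κ lam) k := rfl

/-- [folklore] **`Chol = N⁻¹ • Σ_l aliasTerm`**, `N = n^{3D+2}`. -/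
theorem Chol_eq_sum (n : ℕ) [NeZero n] (k : Fin (d + 1) → ℂ) :
    Chol n k = ((n : ℂ) ^ (3 * (d + 1) + 2))⁻¹ • ∑ l : Fin (d + 1) → Fin n, aliasTerm n l k := by
  ext κ lam
  rw [Chol_apply, covSymMean_apply, Matrix.smul_apply, Matrix.sum_apply, smul_eq_mul]
  congr 1
  exact Finset.sum_congr rfl fun l _ => by rw [aliasTerm_apply]

/-- [our object] the `l ≠ 0` part of the symbol: `Ftil n k := Σ_{l ≠ 0} aliasTerm n l k`. -/
def Ftil (n : ℕ) [NeZero n] (k : Fin (d + 1) → ℂ) : Matrix (Fin (d + 1)) (Fin (d + 1)) ℂ :=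
  ∑ l ∈ Finset.univ.erase (fun _ => (0 : Fin n)), aliasTerm n l k

/-- [folklore] entries of `Ftil`. -/
theorem Ftil_apply (n : ℕ) [NeZero n] (k : Fin (d + 1) → ℂ) (κ lam : Fin (d + 1)) :
    Ftil n k κ lam = ∑ l ∈ Finset.univ.erase (fun _ => (0 : Fin n)),
      cweight n κ (aliasPt n l k) * cweight n lam (-aliasPt n l k) * PC (aliasPt n l k) κ lam := by
  rw [Ftil, Matrix.sum_apply]
  exact Finset.sum_congr rfl fun l _ => aliasTerm_apply n l k κ lam

/-- [folklore] **THE SPLIT `Chol = N⁻¹ • (aliasTerm₀ + Ftil)`**. -/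
theorem Chol_split (n : ℕ) [NeZero n] (k : Fin (d + 1) → ℂ) :
    Chol n k = ((n : ℂ) ^ (3 * (d + 1) + 2))⁻¹ • (aliasTerm n (fun _ => (0 : Fin n)) k + Ftil n k) := by
  rw [Chol_eq_sum, Ftil, ← Finset.add_sum_erase Finset.univ (fun l => aliasTerm n l k) (Finset.mem_univ (fun _ => (0 : Fin n)))]

/-- [our object] **`En := feynC(k/n)·Dwi₀·Ftil·Dwmi₀`** — the relative size of the `l ≠ 0` alias terms against the `l = 0` propagator. -/
def En (n : ℕ) [NeZero n] (k : Fin (d + 1) → ℂ) : Matrix (Fin (d + 1)) (Fin (d + 1)) ℂ :=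
  feynC (aliasPt n (fun _ => (0 : Fin n)) k) * Dwi n (fun _ => (0 : Fin n)) k * Ftil n k * Dwmi n (fun _ => (0 : Fin n)) k

/-- [our object] **`Bn := 1 + En`**. -/
def Bn (n : ℕ) [NeZero n] (k : Fin (d + 1) → ℂ) : Matrix (Fin (d + 1)) (Fin (d + 1)) ℂ := 1 + En n k

/-- [our object] **THE INVERSE SYMBOL `GC := N • Dwmi₀·Bn⁻¹·feynC(k/n)·Dwi₀`** (no `PC(k/n)`: regular at `k = 0`). -/
def GC (n : ℕ) [NeZero n] (k : Fin (d + 1) → ℂ) : Matrix (Fin (d + 1)) (Fin (d + 1)) ℂ :=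
  ((n : ℂ) ^ (3 * (d + 1) + 2)) • (Dwmi n (fun _ => (0 : Fin n)) k * (Bn n k)⁻¹ * feynC (aliasPt n (fun _ => (0 : Fin n)) k) *
    Dwi n (fun _ => (0 : Fin n)) k)

/-! ## §2 Algebra on the fat region -/

/-- [folklore] `N = n^{3D+2} ≠ 0`. -/
theorem N_ne_zero (n : ℕ) [NeZero n] : ((n : ℂ) ^ (3 * (d + 1) + 2)) ≠ 0 :=
  pow_ne_zero _ (Nat.cast_ne_zero.mpr (NeZero.ne n))

/-- [folklore] `Dw·Dwi = 1` when the weights do not vanish. -/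
theorem Dw_mul_Dwi {n : ℕ} {l : Fin (d + 1) → Fin n} {k : Fin (d + 1) → ℂ} (h : ∀ κ, cweight n κ (aliasPt n l k) ≠ 0) :
    Dw n l k * Dwi n l k = 1 := by
  rw [Dw, Dwi, diagonal_mul_diagonal, ← diagonal_one]
  congr 1
  funext κ
  exact mul_inv_cancel₀ (h κ)

/-- [folklore] `Dwi·Dw = 1` when the weights do not vanish. -/
theorem Dwi_mul_Dw {n : ℕ} {l : Fin (d + 1) → Fin n} {k : Fin (d + 1) → ℂ} (h : ∀ κ, cweight n κ (aliasPt n l k) ≠ 0) :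
    Dwi n l k * Dw n l k = 1 := by
  rw [Dw, Dwi, diagonal_mul_diagonal, ← diagonal_one]
  congr 1
  funext κ
  exact inv_mul_cancel₀ (h κ)

/-- [folklore] `Dwm·Dwmi = 1` when the reflected weights do not vanish. -/
theorem Dwm_mul_Dwmi {n : ℕ} {l : Fin (d + 1) → Fin n} {k : Fin (d + 1) → ℂ} (h : ∀ lam, cweight n lam (-aliasPt n l k) ≠ 0) :
    Dwm n l k * Dwmi n l k = 1 := by
  rw [Dwm, Dwmi, diagonal_mul_diagonal, ← diagonal_one]
  congr 1
  funext lam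
  exact mul_inv_cancel₀ (h lam)

/-- [folklore] `Dwmi·Dwm = 1` when the reflected weights do not vanish. -/
theorem Dwmi_mul_Dwm {n : ℕ} {l : Fin (d + 1) → Fin n} {k : Fin (d + 1) → ℂ} (h : ∀ lam, cweight n lam (-aliasPt n l k) ≠ 0) :
    Dwmi n l k * Dwm n l k = 1 := by
  rw [Dwm, Dwmi, diagonal_mul_diagonal, ← diagonal_one]
  congr 1
  funext lam
  exact inv_mul_cancel₀ (h lam)

/-- [folklore] on the fat region `Fat D rA` the `l = 0` weights do not vanish. -/
theorem cw0_ne (n : ℕ) [NeZero n] {k : Fin (d + 1) → ℂ} (hk : k ∈ Fat (d + 1) (rA d)) (κ : Fin (d + 1)) :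
    cweight n κ (aliasPt n (fun _ => (0 : Fin n)) k) ≠ 0 :=
  cweight_aliasZero_ne_zero n (rA_le_quarter d) hk κ

/-- [folklore] on the fat region `Fat D rA` the reflected `l = 0` weights do not vanish. -/
theorem cwm0_ne (n : ℕ) [NeZero n] {k : Fin (d + 1) → ℂ} (hk : k ∈ Fat (d + 1) (rA d)) (lam : Fin (d + 1)) :
    cweight n lam (-aliasPt n (fun _ => (0 : Fin n)) k) ≠ 0 :=
  cweight_neg_aliasZero_ne_zero n (rA_le_quarter d) hk lam

/-- [our object] **THE STRUCTURE IDENTITY**: on the fat region, if `feynC(k/n)` is invertible then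
`Chol n k = N⁻¹ • (Dw₀ · PC(k/n) · Bn · Dwm₀)` — the `l ≠ 0` alias terms are absorbed into the factor `Bn = 1 + En`. -/
theorem Chol_structure (n : ℕ) [NeZero n] {k : Fin (d + 1) → ℂ} (hk : k ∈ Fat (d + 1) (rA d))
    (hF : IsUnit (feynC (aliasPt n (fun _ => (0 : Fin n)) k)).det) :
    Chol n k = ((n : ℂ) ^ (3 * (d + 1) + 2))⁻¹ •
      (Dw n (fun _ => (0 : Fin n)) k * PC (aliasPt n (fun _ => (0 : Fin n)) k) * Bn n k * Dwm n (fun _ => (0 : Fin n)) k) := by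
  rw [Chol_split]
  congr 1
  rw [Bn, Matrix.mul_add, Matrix.mul_one, Matrix.add_mul, aliasTerm]
  congr 1
  have h1 : PC (aliasPt n (fun _ => (0 : Fin n)) k) * feynC (aliasPt n (fun _ => (0 : Fin n)) k) = 1 := Matrix.nonsing_inv_mul _ hF
  rw [En]
  simp only [← Matrix.mul_assoc]
  rw [Matrix.mul_assoc (Dw n _ k) (PC _), h1, Matrix.mul_one, Dw_mul_Dwi (cw0_ne n hk), Matrix.one_mul, Matrix.mul_assoc (Ftil n k),
    Dwmi_mul_Dwm (cwm0_ne n hk), Matrix.mul_one]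

/-- [our object] **`Bn` READ OFF THE SYMBOL**: on the fat region, if `feynC(k/n)` is invertible then `Bn = N • feynC(k/n)·Dwi₀·Chol·Dwmi₀`. -/
theorem Bn_eq (n : ℕ) [NeZero n] {k : Fin (d + 1) → ℂ} (hk : k ∈ Fat (d + 1) (rA d))
    (hF : IsUnit (feynC (aliasPt n (fun _ => (0 : Fin n)) k)).det) :
    Bn n k = ((n : ℂ) ^ (3 * (d + 1) + 2)) •
      (feynC (aliasPt n (fun _ => (0 : Fin n)) k) * Dwi n (fun _ => (0 : Fin n)) k * Chol n k * Dwmi n (fun _ => (0 : Fin n)) k) := by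
  rw [Chol_structure n hk hF, Matrix.mul_smul, Matrix.smul_mul, smul_smul, mul_inv_cancel₀ (N_ne_zero n), one_smul]
  have h1 : feynC (aliasPt n (fun _ => (0 : Fin n)) k) * PC (aliasPt n (fun _ => (0 : Fin n)) k) = 1 := Matrix.mul_nonsing_inv _ hF
  simp only [← Matrix.mul_assoc]
  rw [Matrix.mul_assoc (feynC _) (Dwi n _ k), Dwi_mul_Dw (cw0_ne n hk), Matrix.mul_one, h1, Matrix.one_mul, Matrix.mul_assoc (Bn n k),
    Dwm_mul_Dwmi (cwm0_ne n hk), Matrix.mul_one]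

/-- [our object] **`GC·Chol = 1`** on the fat region, given `feynC(k/n)` and `Bn` invertible. -/
theorem GC_mul_Chol (n : ℕ) [NeZero n] {k : Fin (d + 1) → ℂ} (hk : k ∈ Fat (d + 1) (rA d))
    (hF : IsUnit (feynC (aliasPt n (fun _ => (0 : Fin n)) k)).det) (hB : IsUnit (Bn n k).det) : GC n k * Chol n k = 1 := by
  rw [Chol_structure n hk hF, GC, Matrix.smul_mul, Matrix.mul_smul, smul_smul, mul_inv_cancel₀ (N_ne_zero n), one_smul]
  have h1 : feynC (aliasPt n (fun _ => (0 : Fin n)) k) * PC (aliasPt n (fun _ => (0 : Fin n)) k) = 1 := Matrix.mul_nonsing_inv _ hF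
  have h2 : (Bn n k)⁻¹ * Bn n k = 1 := Matrix.nonsing_inv_mul _ hB
  simp only [← Matrix.mul_assoc]
  rw [Matrix.mul_assoc _ (Dwi n _ k) (Dw n _ k), Dwi_mul_Dw (cw0_ne n hk), Matrix.mul_one, Matrix.mul_assoc _ (feynC _) (PC _), h1,
    Matrix.mul_one, Matrix.mul_assoc _ (Bn n k)⁻¹ (Bn n k), h2, Matrix.mul_one, Dwmi_mul_Dwm (cwm0_ne n hk)]

/-- [our object] **`Chol·GC = 1`** likewise. -/
theorem Chol_mul_GC (n : ℕ) [NeZero n] {k : Fin (d + 1) → ℂ} (hk : k ∈ Fat (d + 1) (rA d))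
    (hF : IsUnit (feynC (aliasPt n (fun _ => (0 : Fin n)) k)).det) (hB : IsUnit (Bn n k).det) : Chol n k * GC n k = 1 :=
  mul_eq_one_comm.mp (GC_mul_Chol n hk hF hB)

/-- [our object] hence `GC = Chol⁻¹` wherever `feynC(k/n)` and `Bn` are invertible. -/
theorem GC_eq_Chol_inv (n : ℕ) [NeZero n] {k : Fin (d + 1) → ℂ} (hk : k ∈ Fat (d + 1) (rA d))
    (hF : IsUnit (feynC (aliasPt n (fun _ => (0 : Fin n)) k)).det) (hB : IsUnit (Bn n k).det) : GC n k = (Chol n k)⁻¹ :=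
  (Matrix.inv_eq_left_inv (GC_mul_Chol n hk hF hB)).symm

/-- [folklore] and `Chol` is invertible there. -/
theorem isUnit_Chol_det (n : ℕ) [NeZero n] {k : Fin (d + 1) → ℂ} (hk : k ∈ Fat (d + 1) (rA d))
    (hF : IsUnit (feynC (aliasPt n (fun _ => (0 : Fin n)) k)).det) (hB : IsUnit (Bn n k).det) : IsUnit (Chol n k).det :=
  Matrix.isUnit_det_of_left_inverse (GC_mul_Chol n hk hF hB)

/-- [folklore] the left inverse of `Bn` read off the inverse symbol: `(N⁻¹ • Dwm₀·Chol⁻¹·Dw₀·PC(k/n))·Bn = 1` when `feynC(k/n)` and `Chol` are invertible. -/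
theorem Bn_left_inv (n : ℕ) [NeZero n] {k : Fin (d + 1) → ℂ} (hk : k ∈ Fat (d + 1) (rA d))
    (hF : IsUnit (feynC (aliasPt n (fun _ => (0 : Fin n)) k)).det) (hC : IsUnit (Chol n k).det) :
    (((n : ℂ) ^ (3 * (d + 1) + 2))⁻¹ •
      (Dwm n (fun _ => (0 : Fin n)) k * (Chol n k)⁻¹ * Dw n (fun _ => (0 : Fin n)) k * PC (aliasPt n (fun _ => (0 : Fin n)) k))) * Bn n k = 1 := by
  rw [Bn_eq n hk hF, Matrix.smul_mul, Matrix.mul_smul, smul_smul, inv_mul_cancel₀ (N_ne_zero n), one_smul]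
  have h1 : PC (aliasPt n (fun _ => (0 : Fin n)) k) * feynC (aliasPt n (fun _ => (0 : Fin n)) k) = 1 := Matrix.nonsing_inv_mul _ hF
  have h2 : (Chol n k)⁻¹ * Chol n k = 1 := Matrix.nonsing_inv_mul _ hC
  simp only [← Matrix.mul_assoc]
  rw [Matrix.mul_assoc _ (PC _) (feynC _), h1, Matrix.mul_one, Matrix.mul_assoc _ (Dw n _ k) (Dwi n _ k), Dw_mul_Dwi (cw0_ne n hk),
    Matrix.mul_one, Matrix.mul_assoc _ (Chol n k)⁻¹ (Chol n k), h2, Matrix.mul_one, Dwm_mul_Dwmi (cwm0_ne n hk)]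

/-- [our object] **`Bn⁻¹` READ OFF THE INVERSE SYMBOL**: on the fat region, if `feynC(k/n)` and `Chol` are invertible then
`Bn⁻¹ = N⁻¹ • Dwm₀·Chol⁻¹·Dw₀·PC(k/n)`. -/
theorem Bn_inv_eq (n : ℕ) [NeZero n] {k : Fin (d + 1) → ℂ} (hk : k ∈ Fat (d + 1) (rA d))
    (hF : IsUnit (feynC (aliasPt n (fun _ => (0 : Fin n)) k)).det) (hC : IsUnit (Chol n k).det) :
    (Bn n k)⁻¹ = ((n : ℂ) ^ (3 * (d + 1) + 2))⁻¹ •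
      (Dwm n (fun _ => (0 : Fin n)) k * (Chol n k)⁻¹ * Dw n (fun _ => (0 : Fin n)) k * PC (aliasPt n (fun _ => (0 : Fin n)) k)) :=
  Matrix.inv_eq_left_inv (Bn_left_inv n hk hF hC)

/-- [folklore] and `Bn` is invertible there. -/
theorem isUnit_Bn_det (n : ℕ) [NeZero n] {k : Fin (d + 1) → ℂ} (hk : k ∈ Fat (d + 1) (rA d))
    (hF : IsUnit (feynC (aliasPt n (fun _ => (0 : Fin n)) k)).det) (hC : IsUnit (Chol n k).det) : IsUnit (Bn n k).det :=
  Matrix.isUnit_det_of_left_inverse (Bn_left_inv n hk hF hC)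

/-! ## §3 The zero momentum -/

/-- [folklore] `p̂(0) = 0`. -/
theorem d1C_zero : d1C (0 : Fin (d + 1) → ℂ) = 0 := by
  funext a; simp [d1C_apply]

/-- [folklore] **`feynC 0 = 0`** (every term carries a factor `p̂(0) = 0` or `p̂(−0) = 0`). -/
theorem feynC_zero : feynC (0 : Fin (d + 1) → ℂ) = 0 := by
  ext α β
  simp only [feynC, exC, neg_zero, d1C_zero, curlRow, Pi.zero_apply, Matrix.zero_apply]
  simp

/-- [folklore] the `l = 0` alias point of `0` is `0`. -/
theorem aliasPt_zero_zero (n : ℕ) [NeZero n] : aliasPt n (fun _ => (0 : Fin n)) (0 : Fin (d + 1) → ℂ) = 0 := by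
  funext i; simp [aliasPt_zero_apply]

/-- [our object] `En n 0 = 0`. -/
theorem En_zero (n : ℕ) [NeZero n] : En n (0 : Fin (d + 1) → ℂ) = 0 := by
  rw [En, aliasPt_zero_zero, feynC_zero]; simp

/-- [our object] `Bn n 0 = 1`. -/
theorem Bn_zero (n : ℕ) [NeZero n] : Bn n (0 : Fin (d + 1) → ℂ) = 1 := by
  rw [Bn, En_zero, add_zero]

/-- [our object] **`GC n 0 = 0`** (the zero mode: the coarse covariance has no inverse at `k = 0`, and the regular factorisation reads `0` there). -/
theorem GC_zero (n : ℕ) [NeZero n] : GC n (0 : Fin (d + 1) → ℂ) = 0 := by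
  rw [GC, aliasPt_zero_zero, feynC_zero]; simp

end Summit.QuantumFields.BalabanUV.Beta.FP.CoarseCovarianceStrip

end
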